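import Summits.AtomisticToContinuum.BoseEinsteinCondensation.Theorems.BECConjugateDominationHardCoreExtensionPairCutoff
import HarnessLib

/-!
# A smooth pair cut-off with a gradient constant uniform in the core radius: stub
# `stub_pairCutoffExistsUniform` (E2U) of line `third-law-current-floor`, crux
# `BECConjugateDomination.HardCoreExtension` (stmt-…-11786)

For `N` particles on `ℝ³/Lℤ³`, a core radius `a` and a shell width `ℓ ∈ (0, a]` the file
`…HardCoreExtensionPairCutoff.lean` builds a `C¹`, `Lℤ³`-periodic, Bose-symmetric
`χ : (ℝ³)^N → [0, 1]` with `χ = 0` as soon as some image pair distance `|xᵢ - xⱼ - Ln|` is `≤ a`,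
`χ = 1` when all of them are `≥ a + ℓ`, `|∇χ|² ≤ C/ℓ²` and `∇χ = 0` off the shells:
`χ = smoothTransition ∘ (1 - H)`, `H = (∑_{i<j} w^per(xᵢ - xⱼ)).toReal`, `w(r) = φ(r²)` with `φ`
a smooth step in the squared distance between `a²` and `(a + ℓ)²`. Its gradient constant is
`C = 3N(4N²KM₁²)²` with `M₁` a bound of `|smoothTransition'|` and `K` any bound on the number
of lattice images of a point of `ℝ³` in a ball of radius `a + ℓ ≤ 2a`. Here we record that
construction with the explicit constant (`exists_pairCutoff_of_card_le`) and choose `K` at the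
radius `2a₀`: the resulting `C = C(N, L, a₀)` serves every core radius `a ≤ a₀`
(`stub_pairCutoffExistsUniform`). Standard smooth IMS-type cut-off. [folklore]
-/

noncomputable section

namespace Summit.AtomisticToContinuum.BoseEinsteinCondensation.Cruxes.HardCoreExtension.ThirdLawCurrentFloor

open MeasureTheory Filter
open scoped ENNReal NNReal BigOperators Topology RealInnerProductSpace
open Literature.MathematicalPhysics.QuantumManyBody.BoseGas
open Summit.AtomisticToContinuum.BoseEinsteinCondensation.Theorems.PositiveMinimiser

/-! ### The cut-off with an explicit gradient constant -/

/-- **Smooth pair cut-off with an explicit gradient constant.** For `0 < L`, `0 < a`, a shell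
width `ℓ > 0`, a bound `M₁ ≥ 0` of `|smoothTransition'|` and a bound `K` on the number of lattice
images of any point of `ℝ³` within distance `a + ℓ`, there is a `C¹`, `Lℤ³`-periodic,
Bose-symmetric `χ : (ℝ³)^N → [0, 1]` vanishing whenever some image pair distance is `≤ a`, equal
to `1` when all image pair distances are `≥ a + ℓ`, with `|∇χ|² ≤ 3N(4N²KM₁²)²/ℓ²` everywhere and
`∇χ = 0` off the shells (`χ = smoothTransition (1 - H)` as in the module docstring). [folklore] -/
theorem exists_pairCutoff_of_card_le {N : ℕ} {L a ℓ M₁ : ℝ} {K : ℕ} (hL : 0 < L) (ha : 0 < a)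
    (hℓ : 0 < ℓ) (hM₁0 : 0 ≤ M₁) (hM₁ : ∀ t, |deriv Real.smoothTransition t| ≤ M₁)
    (hK : ∀ (y : Space) (s : Finset (Fin 3 → ℤ)),
      (∀ n ∈ s, ‖y - latticeVec L n‖ ≤ a + ℓ) → s.card ≤ K) :
    ∃ χ : Config N → ℝ, ContDiff ℝ 1 χ ∧
      (∀ (X : Config N) (i : Fin N) (k : Fin 3),
        χ (X + Pi.single i (EuclideanSpace.single k L)) = χ X) ∧
      (∀ (σ : Equiv.Perm (Fin N)) (X : Config N), χ (X ∘ σ) = χ X) ∧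
      (∀ X, 0 ≤ χ X ∧ χ X ≤ 1) ∧
      (∀ X : Config N,
        (∃ i j : Fin N, i ≠ j ∧ ∃ n : Fin 3 → ℤ, ‖X i - X j - latticeVec L n‖ ≤ a) → χ X = 0) ∧
      (∀ X : Config N,
        (∀ i j : Fin N, i ≠ j → ∀ n : Fin 3 → ℤ, a + ℓ ≤ ‖X i - X j - latticeVec L n‖) →
          χ X = 1) ∧
      (∀ X : Config N, kineticDensity (fun Y => (χ Y : ℂ)) X ≤
        ENNReal.ofReal (3 * N * (4 * N ^ 2 * K * M₁ ^ 2) ^ 2 / ℓ ^ 2)) ∧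
      (∀ X : Config N, (∀ i j : Fin N, i ≠ j → ∀ n : Fin 3 → ℤ,
          ‖X i - X j - latticeVec L n‖ ≤ a ∨ a + ℓ ≤ ‖X i - X j - latticeVec L n‖) →
        kineticDensity (fun Y => (χ Y : ℂ)) X = 0) := by
  obtain ⟨φ, hφC, hφ0, -, hφa, hφaℓ, hφB, hφ'0⟩ := exists_sqProfile ha hℓ hM₁
  have hρ : 0 ≤ a + ℓ := by positivity
  have hd0 : 0 < (a + ℓ) ^ 2 - a ^ 2 := by nlinarith
  have hsTC : ContDiff ℝ 1 Real.smoothTransition := Real.smoothTransition.contDiff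
  have hwR : ∀ r, a + ℓ < r → ENNReal.ofReal (φ (r ^ 2)) = 0 := fun r hr => by
    rw [hφaℓ _ (pow_le_pow_left₀ hρ hr.le 2), ENNReal.ofReal_zero]
  have hwfin : ∀ r, ENNReal.ofReal (φ (r ^ 2)) ≠ ⊤ := fun _ => ENNReal.ofReal_ne_top
  have hwC : ContDiff ℝ 1 fun y : Space => (ENNReal.ofReal (φ (‖y‖ ^ 2))).toReal := by
    have : (fun y : Space => (ENNReal.ofReal (φ (‖y‖ ^ 2))).toReal) = fun y => φ (‖y‖ ^ 2) :=
      funext fun y => ENNReal.toReal_ofReal (hφ0 _)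
    exact this ▸ hφC.comp (contDiff_norm_sq ℝ)
  have hHC : ContDiff ℝ 1 fun X : Config N =>
      (periodicInteraction (fun r => ENNReal.ofReal (φ (r ^ 2))) L X).toReal :=
    contDiff_toReal_periodicInteraction hL hwR hwfin hwC
  have hφ'ρ : ∀ s, (a + ℓ) ^ 2 ≤ s → deriv φ s = 0 := fun s hs => hφ'0 s (Or.inr hs)
  have hχd : Differentiable ℝ fun X : Config N => Real.smoothTransition (1 -
      (periodicInteraction (fun r => ENNReal.ofReal (φ (r ^ 2))) L X).toReal) :=
    (hsTC.comp (contDiff_const.sub hHC)).differentiable one_ne_zero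
  have hχ' : ∀ X : Config N, HasFDerivAt (fun Y : Config N => Real.smoothTransition (1 -
      (periodicInteraction (fun r => ENNReal.ofReal (φ (r ^ 2))) L Y).toReal))
      (deriv Real.smoothTransition (1 -
        (periodicInteraction (fun r => ENNReal.ofReal (φ (r ^ 2))) L X).toReal) •
        (0 - fderiv ℝ (fun Y : Config N =>
          (periodicInteraction (fun r => ENNReal.ofReal (φ (r ^ 2))) L Y).toReal) X)) X := fun X =>
    ((hsTC.differentiable one_ne_zero) _).hasDerivAt.comp_hasFDerivAt X
      ((hasFDerivAt_const (1 : ℝ) X).sub ((hHC.differentiable one_ne_zero) X).hasFDerivAt)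
  have hgrad : ∀ (X : Config N) (i : Fin N) (k : Fin 3),
      |fderiv ℝ (fun Y : Config N => Real.smoothTransition (1 -
        (periodicInteraction (fun r => ENNReal.ofReal (φ (r ^ 2))) L Y).toReal)) X
          (Pi.single i (EuclideanSpace.single k (1 : ℝ)))| ≤ 4 * N ^ 2 * K * M₁ ^ 2 / ℓ := by
    intro X i k
    rw [(hχ' X).fderiv, smul_apply, sub_apply, zero_apply, zero_sub, smul_eq_mul, abs_mul, abs_neg]
    have h3 := abs_fderiv_toReal_periodicInteraction_le hL hφC hφ0 hρ hφaℓ hφ'ρ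
      (div_nonneg hM₁0 hd0.le) hφB hK X (Pi.single i (EuclideanSpace.single k (1 : ℝ)))
    have hv1 : ‖(Pi.single i (EuclideanSpace.single k (1 : ℝ)) : Config N)‖ = 1 := by
      rw [Pi.norm_single]; simp
    rw [hv1, mul_one] at h3
    refine (mul_le_mul (hM₁ _) h3 (abs_nonneg _) hM₁0).trans ?_
    rw [div_eq_mul_one_div M₁, div_eq_mul_one_div _ ℓ]
    have hkey : (a + ℓ) * (1 / ((a + ℓ) ^ 2 - a ^ 2)) ≤ 1 / ℓ := by
      rw [mul_one_div, div_le_div_iff₀ hd0 hℓ, one_mul]; nlinarith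
    have hNK : 0 ≤ (N : ℝ) ^ 2 * K * M₁ * M₁ * 4 := by positivity
    calc M₁ * ((N : ℝ) ^ 2 * K * (M₁ * (1 / ((a + ℓ) ^ 2 - a ^ 2)) * (2 * ((a + ℓ) * 2))))
        = (N : ℝ) ^ 2 * K * M₁ * M₁ * 4 * ((a + ℓ) * (1 / ((a + ℓ) ^ 2 - a ^ 2))) := by ring
      _ ≤ (N : ℝ) ^ 2 * K * M₁ * M₁ * 4 * (1 / ℓ) := mul_le_mul_of_nonneg_left hkey hNK
      _ = 4 * N ^ 2 * K * M₁ ^ 2 * (1 / ℓ) := by ring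
  refine ⟨fun X => Real.smoothTransition (1 -
      (periodicInteraction (fun r => ENNReal.ofReal (φ (r ^ 2))) L X).toReal),
    hsTC.comp (contDiff_const.sub hHC), fun X i k => ?_, fun σ X => ?_,
    fun X => ⟨Real.smoothTransition.nonneg _, Real.smoothTransition.le_one _⟩,
    fun X hX => ?_, fun X hX => ?_, fun X => ?_, fun X hX => ?_⟩
  · beta_reduce; rw [toReal_periodicInteraction_periodic] -- periodicity
  · beta_reduce -- Bose symmetry
    have : periodicInteraction (fun r => ENNReal.ofReal (φ (r ^ 2))) L (X ∘ σ) =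
        periodicInteraction (fun r => ENNReal.ofReal (φ (r ^ 2))) L X :=
      periodicInteraction_comp_equiv _ L σ X
    rw [this]
  · obtain ⟨i, j, hij, n, hn⟩ := hX -- an image pair at distance `≤ a` forces `H ≥ 1`, `χ = 0`
    refine Real.smoothTransition.zero_of_nonpos (sub_nonpos.2 ?_)
    have h1 : (1 : ℝ≥0∞) ≤ periodicInteraction (fun r => ENNReal.ofReal (φ (r ^ 2))) L X := by
      have h := apply_le_periodicInteraction (fun r => ENNReal.ofReal (φ (r ^ 2))) L X hij n
      rwa [hφa _ (pow_le_pow_left₀ (norm_nonneg _) hn 2), ENNReal.ofReal_one] at h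
    have := ENNReal.toReal_mono (ENNReal.sum_ne_top.2 fun _ _ => ENNReal.sum_ne_top.2 fun _ _ =>
      periodizedPotential_ne_top hL hwR hwfin _) h1
    rwa [ENNReal.toReal_one] at this
  · beta_reduce -- all image pairs at distance `≥ a + ℓ` force `H = 0`, `χ = 1`
    rw [periodicInteraction_eq_zero_of_forall _ L X fun i j hij n => by
      rw [hφaℓ _ (pow_le_pow_left₀ hρ (hX i j hij n) 2), ENNReal.ofReal_zero],
      ENNReal.toReal_zero, sub_zero]
    exact Real.smoothTransition.one_of_one_le le_rfl
  · beta_reduce -- the gradient bound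
    rw [kineticDensity_ofReal hχd, realKinetic_eq_ofReal]
    refine ENNReal.ofReal_le_ofReal ?_
    calc ∑ i : Fin N, ∑ k : Fin 3, (fderiv ℝ (fun Y : Config N => Real.smoothTransition (1 -
            (periodicInteraction (fun r => ENNReal.ofReal (φ (r ^ 2))) L Y).toReal)) X
              (Pi.single i (EuclideanSpace.single k (1 : ℝ)))) ^ 2
        ≤ ∑ _i : Fin N, ∑ _k : Fin 3, (4 * N ^ 2 * K * M₁ ^ 2 / ℓ) ^ 2 :=
          Finset.sum_le_sum fun i _ => Finset.sum_le_sum fun k _ =>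
            (sq_abs _).symm.trans_le (pow_le_pow_left₀ (abs_nonneg _) (hgrad X i k) 2)
      _ = 3 * N * (4 * N ^ 2 * K * M₁ ^ 2) ^ 2 / ℓ ^ 2 := by
          simp only [Finset.sum_const, Finset.card_univ, Fintype.card_fin, nsmul_eq_mul]
          rw [div_pow]; push_cast; ring
  · beta_reduce -- off the shells the gradient vanishes
    rw [kineticDensity_ofReal hχd, realKinetic_eq_ofReal, (hχ' X).fderiv,
      fderiv_toReal_periodicInteraction_eq_zero hL hφC hφ0 hρ hφaℓ X fun i j hij n =>
        (hX i j hij n).elim (fun h => hφ'0 _ (Or.inl (pow_le_pow_left₀ (norm_nonneg _) h 2)))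
          fun h => hφ'0 _ (Or.inr (pow_le_pow_left₀ hρ h 2)), sub_zero, smul_zero]
    simp

/-! ### The cut-off with a constant uniform in the core radius -/

/-- **Smooth pair cut-off removing the hard-core shell, uniformly in the core radius** (stub
`stub_pairCutoffExistsUniform`, node E2U of the `C¹`-cut-off scheme): for `0 < L`, `0 < a₀` there
is `C = C(N, L, a₀) ≥ 0` such that for every core radius `a ≤ a₀` and shell width `ℓ ∈ (0, a]`
there is a `C¹`, `Lℤ³`-periodic, Bose-symmetric `χ : (ℝ³)^N → [0, 1]` vanishing whenever some
image pair distance is `≤ a`, equal to `1` when all image pair distances are `≥ a + ℓ`, with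
`|∇χ|² ≤ C/ℓ²` everywhere and `∇χ = 0` off the shells. The constant is that of
`stub_pairCutoffExists` with the lattice count `K` taken at radius `2a₀ ≥ a + ℓ`. [folklore] -/
theorem stub_pairCutoffExistsUniform :
    ∀ (N : ℕ) (L a₀ : ℝ), 0 < L → 0 < a₀ → ∃ C : ℝ, 0 ≤ C ∧ ∀ a ℓ : ℝ, 0 < ℓ → ℓ ≤ a → a ≤ a₀ →
      ∃ χ : Config N → ℝ, ContDiff ℝ 1 χ ∧
        (∀ (X : Config N) (i : Fin N) (k : Fin 3),
          χ (X + Pi.single i (EuclideanSpace.single k L)) = χ X) ∧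
        (∀ (σ : Equiv.Perm (Fin N)) (X : Config N), χ (X ∘ σ) = χ X) ∧
        (∀ X, 0 ≤ χ X ∧ χ X ≤ 1) ∧
        (∀ X : Config N,
          (∃ i j : Fin N, i ≠ j ∧ ∃ n : Fin 3 → ℤ, ‖X i - X j - latticeVec L n‖ ≤ a) → χ X = 0) ∧
        (∀ X : Config N,
          (∀ i j : Fin N, i ≠ j → ∀ n : Fin 3 → ℤ, a + ℓ ≤ ‖X i - X j - latticeVec L n‖) →
            χ X = 1) ∧
        (∀ X : Config N, kineticDensity (fun Y => (χ Y : ℂ)) X ≤ ENNReal.ofReal (C / ℓ ^ 2)) ∧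
        (∀ X : Config N, (∀ i j : Fin N, i ≠ j → ∀ n : Fin 3 → ℤ,
            ‖X i - X j - latticeVec L n‖ ≤ a ∨ a + ℓ ≤ ‖X i - X j - latticeVec L n‖) →
          kineticDensity (fun Y => (χ Y : ℂ)) X = 0) := by
  intro N L a₀ hL _
  obtain ⟨M₁, hM₁0, hM₁⟩ : ∃ M : ℝ, 0 ≤ M ∧ ∀ t, |deriv Real.smoothTransition t| ≤ M := by
    obtain ⟨M, hM0, hM⟩ := exists_bound_deriv_smoothTransition
    refine ⟨M, hM0, fun t => ?_⟩
    rcases le_or_gt t 0 with ht | ht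
    · rw [deriv_smoothTransition_of_nonpos ht, abs_zero]; exact hM0
    rcases le_or_gt 1 t with ht' | ht'
    · rw [deriv_smoothTransition_of_one_le ht', abs_zero]; exact hM0
    · exact hM t ⟨ht.le, ht'.le⟩
  obtain ⟨K, hK⟩ := exists_card_latticeVec_near_le hL (2 * a₀)
  refine ⟨3 * N * (4 * N ^ 2 * K * M₁ ^ 2) ^ 2, by positivity, fun a ℓ hℓ hℓa haa₀ => ?_⟩
  exact exists_pairCutoff_of_card_le hL (hℓ.trans_le hℓa) hℓ hM₁0 hM₁ fun y s hs =>
    hK y s fun n hn => (hs n hn).trans (by linarith)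

end Summit.AtomisticToContinuum.BoseEinsteinCondensation.Cruxes.HardCoreExtension.ThirdLawCurrentFloor
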